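import Summits.QuantumFields.BalabanUV.Beta.GAN24.CouplingLetterDiagrams
import Summits.QuantumFields.BalabanUV.Beta.GAN24.BackgroundExpansionTaylor

/-!
# `BalabanUV.Beta.GAN24.CovariantLaplacianTaylorLine` — binder row G-an2-4 ∕ (CONV-C), route R7 «TWO CURRENCIES», PART 239: EVERY u-DERIVATIVE AT `u = 0` OF THE INVERSE EFFECTIVE
# COVARIANCE `(c_k(u))⁻¹`, `c_k(u) = L^{dk}Q_k(Δ_a^{(k)} + u·A^{(k)})⁻¹Q_kᴴ`, ALONG THE LINE THROUGH A COUPLING LETTER `A = P(V₁) + P(V₂)ᴴ + diag W`, ON `ℤ^d`, MODULO ONLY EL₁ — and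
# §2, THE INSTANCE that closes the census's «first-order MODEL framing» for the abelian covariant VECTOR LAPLACIAN: along `u ↦ Δ_a^{(k)} + u·(Δ^{U_{t,k}} − Δ^{1,(k)})` for ANY
# volume-indexed family of abelian transporters `U_t` whose connections `−w = −η⁻¹(U − 1)` are Lipschitz `(α, β)` and whose zeroth-order fields `z` are bounded `(α′, β′)` uniformly in
# the volume, DISPLAYING ONLY EL₁ OF THE TRANSPORTERS — `Δ^{U} − Δ^{1} = P(−w) + P(−w)ᴴ + diag z` is NE2's `AbelianCovariantLaplacian.covPert_eq`, an EXACT identity (no model, no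
# truncation); every Neumann coefficient `∂^N_u|₀` of the effective form of `Δ_a + (Δ^U − Δ^1)` is in the β-cell's `LimitRate` currency.  PART 161 §3 VERBATIM over PART 238
# (unit b2b-balaban-gan24-p3, gen 65; v1; generator `HOME/b2b-balaban-gan24-p3/gen65/records/gen/gen238.py` over the tree text of PART 161)

NOT IN PRINT; OUR PROOF ([folklore] bookkeeping BY NAME over PART 161 §1–§2 (`iteratedDeriv_inv_eq_diagramSum` — Faà di Bruno for the inverse of a resolvent read-out, GENERIC in
`(D, P, Φ)` —, `chainPow_eq_word`, `exists_clm_avgTow`), PART 238 (`conv_couplingDiagramSum_of_tendsto_background`), PART 118 (`isUnit_det_unitCovB_and_opNorm_inv_le`), NE2's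
`AbelianCovariantLaplacian` (`covPert`, `connV`, `zT`, `covPert_eq`, `conn`, `zfield`, `negConn`, `tauInv`), `isUnit_det_calDalev`; [Balaban1985BackgroundPropagators] (3.3) p. 390 and
[Balaban1987RG1] (1.21)–(1.22) p. 264 LOCATE the shapes; nothing printed is a hypothesis).
HONEST FRAMING (cell contract, verbatim): «discharging `BetaPertH` makes Bałaban's UV stability UNCONDITIONAL — a real constructive-QFT result; it is NOT the
continuum limit and NOT the Clay problem.»  HONEST DEPENDENCY (verbatim): «continuum YM on T⁴ ⇐ BetaPertH ∧ nine spine estimates (0/9 proved); BetaPertH ⇐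
(D1) ∧ (D4) ∧ CAP+tail; G-an2-4 gates asym, D1 and NE2/3/4.»

WHAT THIS FILE PROVES (0 sorry, 0 `def`; `d ≥ 3`, `L ≥ 2`, `a > 0`, `μ ≠ ν`, even cubic volumes `2(t+1)`, every order `N`; conclusions = `∃ κ > 0, B, B′ ≥ 0, Π` with `IsInfiniteVolumeLimit`,
`UniformDecay Π μ ν B (κ∕d)`, `StepRate Π μ ν B′ (κ∕d) (√(L⁻¹))`, `KernelInputs d Π`, `∀ k, |secondMoment (Π k) μ ν − secondMoment (limKernelOf Π) μ ν| ≤ β′_d(B′∕(1−√(L⁻¹)), κ∕d)·(√(L⁻¹))^k`):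
* §1 **`conv_iteratedDeriv_invPertCov_coupling_of_tendsto_background`** (one volume-indexed coupling letter `A_t = P(V₁,t) + P(V₂,t)ᴴ + diag W_t`, `(α, β, α′, β′)` uniform, EL₁ displayed:
  the tower family `(t, k) ↦ ∂^N_u[(c_k(u))⁻¹]|_{u=0}`), **`conv_iteratedDeriv_effFormPert_coupling_of_tendsto_background`** (the same for `Σ_k(u) = c_k(u)⁻¹ − a″1`, `N ≥ 1`).
* §2 THE EXACT ABELIAN COVARIANT LAPLACIAN: `tendsto_connV_of_tendsto`, `tendsto_zT_of_tendsto` (EL₁ of `−w_t`, `z_t` from EL₁ of the transporters — finite stencils at fixed level),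
  **`conv_iteratedDeriv_invCov_covariantLaplacian_of_tendsto`**, **`conv_iteratedDeriv_effForm_covariantLaplacian_of_tendsto`**.
WHAT IT DOES NOT DO: CURVES of transporters `s ↦ U_s` (the background enters `Δ^U` nonlinearly; derivatives along a curve are diagrams in the DERIVATIVE letters `∂^j_s(Δ^{U_s} − Δ^1)|₀`,
again coupling letters — follower PARTs); base points `u₀ ≠ 0` (PART 163's disc for coupling letters); Bałaban's `−∂P∂*` ∕ `aQ(U)*Q(U)` parts of `Δ_a(U)` and the non-abelian colour structure
(NE2's tier B `ColourCovariantLaplacian`); `d ≤ 2` ∕ odd volumes.  SUPPLIER work; NEVER «G-an2-4 closed»; NOT (CONV-C), NOT D1, NOT `BetaPertH`, NOT continuum, NOT Clay.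
Records: `HOME/b2b-balaban-gan24-p3/gen65/README.md`.
-/

noncomputable section

open scoped BigOperators ComplexConjugate Matrix Matrix.Norms.L2Operator
open Filter Topology

namespace Summit.QuantumFields.BalabanUV.Beta.GAN24.CovariantLaplacianTaylorLine

open Literature.MathematicalPhysics.QuantumFieldTheory.Balaban1983to89
open Literature.MathematicalPhysics.QuantumFieldTheory.Balaban1983to89.B5Prop11Plancherel (Tor fine unitVec)
open Literature.MathematicalPhysics.QuantumFieldTheory.Balaban1983to89.B5G183RateUnitTower (lev)
open Literature.MathematicalPhysics.QuantumFieldTheory.Balaban1983to89.B12Sec2to5 (betaPrime510)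
open Literature.MathematicalPhysics.QuantumFieldTheory.Balaban1983to89.Beta (Site IsInfiniteVolumeLimit)
open Literature.MathematicalPhysics.QuantumFieldTheory.Balaban1983to89.Beta.FreeLegDictionary (cubic)
open Literature.MathematicalPhysics.QuantumFieldTheory.Balaban1983to89.Beta.BlockKernelVolumeSockets (evenPeriod tendsto_evenPeriod)
open Literature.MathematicalPhysics.QuantumFieldTheory.Balaban1983to89.Beta.VectorTails (castT castT_add castT_neg castT_single)
open Literature.MathematicalPhysics.QuantumFieldTheory.Balaban1983to89.Beta.LimitRate (StepRate limKernelOf KernelInputs)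
open Summit.QuantumFields.BalabanUV.T4Continuum
open Summit.QuantumFields.BalabanUV.T4Continuum.CovariantAveragingTower (Atow avgTow)
open Summit.QuantumFields.BalabanUV.T4Continuum.BalabanAveragedTowerUnit (idx QBlev calGlev unitCovB)
open Summit.QuantumFields.BalabanUV.T4Continuum.BalabanAveragedCoerciveTower (unitIdx)
open Summit.QuantumFields.BalabanUV.T4Continuum.KingPairingPlantedLaw (calDalev calDalev_inv isUnit_det_calDalev)
open Summit.QuantumFields.BalabanUV.T4Continuum.FirstOrderBackgroundModel (LipschitzBackground Pmodel)
open Summit.QuantumFields.BalabanUV.T4Continuum.PerturbationAlgebra (BoundedBackground)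
open Summit.QuantumFields.BalabanUV.T4Continuum.AbelianCovariantLaplacian (covPert connV zT covPert_eq conn zfield negConn tauInv)
open Summit.QuantumFields.BalabanUV.Beta.GAN24.EffectiveFormInsertionLaw (isUnit_det_unitCovB_and_opNorm_inv_le)
open Summit.QuantumFields.BalabanUV.Beta.GAN24.BackgroundExpansionTaylor (iteratedDeriv_inv_eq_diagramSum chainPow_eq_word exists_clm_avgTow)
open Summit.QuantumFields.BalabanUV.Beta.GAN24.CouplingLetterDiagrams (conv_couplingDiagramSum_of_tendsto_background)

variable {d : ℕ} (L : ℕ) [NeZero L] (a : ℝ) (ha : 0 < a)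

/-! ## §1 Every u-derivative of `(c_k(u))⁻¹` at `u = 0` along the line through a coupling letter, modulo only the backgrounds' pointwise limits -/

section Line

/-- **`conv_iteratedDeriv_invPertCov_coupling_of_tendsto_background` — EVERY u-DERIVATIVE OF `(c_k(u))⁻¹` AT `u = 0` ON `ℤ^d`, MODULO ONLY THE BACKGROUND's POINTWISE LIMIT** [our proof]
(`d ≥ 3`, `L ≥ 2`, `a > 0`, `μ ≠ ν`, even cubic volumes `2(t+1)`, every order `N`; a volume-indexed family of Lipschitz backgrounds `V_t` with `(α, β)` uniform DISPLAYING ONLY EL₁):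
the tower family `(t, k) ↦ ∂^N_u[(L^{dk}Q_k(Δ_a^{(k)} + u·A_t^{(k)})⁻¹Q_kᴴ)⁻¹]|_{u=0}` has `∃ κ > 0, B, B′ ≥ 0, Π` with `IsInfiniteVolumeLimit`, `UniformDecay Π μ ν B (κ∕d)`,
`StepRate Π μ ν B′ (κ∕d) (√(L⁻¹))`, `KernelInputs d Π`, `∀ k, |secondMoment (Π k) μ ν − secondMoment (limKernelOf Π) μ ν| ≤ β′_d(B′∕(1−√(L⁻¹)), κ∕d)·(√(L⁻¹))^k` — §2's uniform
Faà di Bruno identity at `u = 0` (letters `c_k⁻¹` and the constant words `X^{(j)}_k` of one background) + PART 160's END for finite `ℤ`-combinations of diagrams.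
[cite: Balaban1987RG1, (1.21)–(1.22) p.264 (shapes)] -/
theorem conv_iteratedDeriv_invPertCov_coupling_of_tendsto_background (hL : 2 ≤ L) (hd : 3 ≤ d) {μ ν : Fin d} (hne : μ ≠ ν) {α β α' β' : ℝ}
    {V₁ V₂ : (t : ℕ) → (k : ℕ) → Fin d → (idx L (cubic d (evenPeriod t)) k → ℂ)} {W : (t : ℕ) → (k : ℕ) → (idx L (cubic d (evenPeriod t)) k → ℂ)}
    (hV₁ : ∀ t, LipschitzBackground L (cubic d (evenPeriod t)) (V₁ t) α β) (hV₂ : ∀ t, LipschitzBackground L (cubic d (evenPeriod t)) (V₂ t) α β)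
    (hW : ∀ t, BoundedBackground L (cubic d (evenPeriod t)) (W t) α' β')
    (hV₁1 : ∀ k (μ f : Fin d) (z : Fin d → ℤ), ∃ s : ℂ, Tendsto (fun t => V₁ t k μ (castT (cubic d (lev L k * evenPeriod t)) z, f)) atTop (𝓝 s))
    (hV₂1 : ∀ k (μ f : Fin d) (z : Fin d → ℤ), ∃ s : ℂ, Tendsto (fun t => V₂ t k μ (castT (cubic d (lev L k * evenPeriod t)) z, f)) atTop (𝓝 s))
    (hW1 : ∀ k (f : Fin d) (z : Fin d → ℤ), ∃ s : ℂ, Tendsto (fun t => W t k (castT (cubic d (lev L k * evenPeriod t)) z, f)) atTop (𝓝 s)) (N : ℕ) :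
    ∃ κ B B' : ℝ, 0 < κ ∧ 0 ≤ B ∧ 0 ≤ B' ∧ ∃ Pinf : ℕ → B12Beta.Kernel d,
      (∀ k, IsInfiniteVolumeLimit evenPeriod
        (fun t μ' ν' (z : Site d (evenPeriod t)) =>
          ((iteratedDeriv N (fun u : ℂ => (avgTow (QBlev L (cubic d (evenPeriod t))) ((L : ℝ) ^ d)
              (fun k' => (calDalev L (cubic d (evenPeriod t)) a ha k' + u • (Pmodel L (cubic d (evenPeriod t)) (V₁ t) k' + (Pmodel L (cubic d (evenPeriod t)) (V₂ t) k')ᴴ + Matrix.diagonal (W t k')))⁻¹) k)⁻¹) 0)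
            ((unitIdx L (cubic d (evenPeriod t))).symm (z, μ')) ((unitIdx L (cubic d (evenPeriod t))).symm (0, ν'))).re) (Pinf k)) ∧
      Beta.LimitRate.UniformDecay Pinf μ ν B (κ / d) ∧ StepRate Pinf μ ν B' (κ / d) (Real.sqrt ((L : ℝ)⁻¹)) ∧
      (∃ K : KernelInputs d Pinf, K.θ = Real.sqrt ((L : ℝ)⁻¹) ∧ K.c₀ = betaPrime510 d (B' / (1 - Real.sqrt ((L : ℝ)⁻¹))) (κ / d) ∧ K.Pinf = limKernelOf Pinf ∧ K.μ = μ ∧ K.ν = ν) ∧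
      (∀ k, |B12Beta.secondMoment (Pinf k) μ ν - B12Beta.secondMoment (limKernelOf Pinf) μ ν|
          ≤ betaPrime510 d (B' / (1 - Real.sqrt ((L : ℝ)⁻¹))) (κ / d) * Real.sqrt ((L : ℝ)⁻¹) ^ k) := by
  obtain ⟨J, hJ, z, ℓ, hN⟩ := iteratedDeriv_inv_eq_diagramSum N
  -- PART 160's END for the combination `Σ_i z_i • diagram((ℓ i).map (Option.map replicate))` over the one-letter alphabet `Unit`
  obtain ⟨κ, B, B', hκ, hB, hB', Pinf, hIVL, hUD, hSR, hK, hsm⟩ :=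
    conv_couplingDiagramSum_of_tendsto_background L a ha (σ := Unit) (V₁ := fun _ => V₁) (V₂ := fun _ => V₂) (W := fun _ => W) hL hd hne (fun _ t => hV₁ t) (fun _ t => hV₂ t) (fun _ t => hW t) (fun _ k => hV₁1 k) (fun _ k => hV₂1 k) (fun _ k => hW1 k)
      Finset.univ (fun i => (z i : ℂ)) (fun i => (ℓ i).map (Option.map fun j => List.replicate j ()))
  refine ⟨κ, B, B', hκ, hB, hB', Pinf, fun k => ?_, hUD, hSR, hK, hsm⟩
  -- the identity at `u = 0`, volume by volume
  have key : ∀ t, iteratedDeriv N (fun u : ℂ => (avgTow (QBlev L (cubic d (evenPeriod t))) ((L : ℝ) ^ d)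
        (fun k' => (calDalev L (cubic d (evenPeriod t)) a ha k' + u • (Pmodel L (cubic d (evenPeriod t)) (V₁ t) k' + (Pmodel L (cubic d (evenPeriod t)) (V₂ t) k')ᴴ + Matrix.diagonal (W t k')))⁻¹) k)⁻¹) 0
      = (∑ i ∈ Finset.univ, (fun i => (z i : ℂ)) i • ((((ℓ i).map (Option.map fun j => List.replicate j ())).map fun o => o.elim
          (fun t k => (unitCovB L (cubic d (evenPeriod t)) a ha k)⁻¹)
          (fun w t k => avgTow (QBlev L (cubic d (evenPeriod t))) ((L : ℝ) ^ d)
            (fun k' => List.foldr (fun i N => calGlev L (cubic d (evenPeriod t)) a ha k' * (Pmodel L (cubic d (evenPeriod t)) ((fun _ : Unit => V₁) i t) k' + (Pmodel L (cubic d (evenPeriod t)) ((fun _ : Unit => V₂) i t) k')ᴴ + Matrix.diagonal ((fun _ : Unit => W) i t k')) * N)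
              (calGlev L (cubic d (evenPeriod t)) a ha k') w) k)).prod)) t k := by
    intro t
    set M := cubic d (evenPeriod t) with hM
    obtain ⟨Φ, hΦ⟩ := exists_clm_avgTow (QBlev L M) ((L : ℝ) ^ d) k
    set D : Matrix (idx L M k) (idx L M k) ℂ := calDalev L M a ha k with hD
    set P : Matrix (idx L M k) (idx L M k) ℂ := Pmodel L M (V₁ t) k + (Pmodel L M (V₂ t) k)ᴴ + Matrix.diagonal (W t k) with hP
    have hF : (fun u : ℂ => (avgTow (QBlev L M) ((L : ℝ) ^ d) (fun k' => (calDalev L M a ha k' + u • (Pmodel L M (V₁ t) k' + (Pmodel L M (V₂ t) k')ᴴ + Matrix.diagonal (W t k')))⁻¹) k)⁻¹)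
        = fun u : ℂ => (Φ (D + u • P)⁻¹)⁻¹ := by
      funext u; rw [hΦ]
    have ec : Φ D⁻¹ = unitCovB L M a ha k := by
      rw [hD, calDalev_inv]
      exact (hΦ (calGlev L M a ha)).symm
    have h0 : IsUnit (D + (0 : ℂ) • P).det := by rw [zero_smul, add_zero]; exact isUnit_det_calDalev L M a ha k
    have hc0 : IsUnit (Φ (D + (0 : ℂ) • P)⁻¹).det := by rw [zero_smul, add_zero, ec]; exact (isUnit_det_unitCovB_and_opNorm_inv_le L M a ha k).1
    rw [hF, hN D P Φ 0 h0 hc0, Finset.sum_apply, Finset.sum_apply]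
    refine Finset.sum_congr rfl fun i _ => ?_
    rw [Pi.smul_apply, Pi.smul_apply, Pi.list_prod_apply, Pi.list_prod_apply, List.map_map, List.map_map, List.map_map]
    congr 1
    refine congrArg List.prod (List.map_congr_left fun o _ => ?_)
    cases o with
    | none =>
      simp only [Function.comp_apply, Option.map_none, Option.elim, zero_smul, add_zero, ec]
      rfl
    | some j =>
      simp only [Function.comp_apply, Option.map_some, Option.elim, zero_smul, add_zero]
      rw [hΦ, hD, calDalev_inv, chainPow_eq_word]
  have e : (fun t μ' ν' (x : Site d (evenPeriod t)) =>
      ((iteratedDeriv N (fun u : ℂ => (avgTow (QBlev L (cubic d (evenPeriod t))) ((L : ℝ) ^ d)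
          (fun k' => (calDalev L (cubic d (evenPeriod t)) a ha k' + u • (Pmodel L (cubic d (evenPeriod t)) (V₁ t) k' + (Pmodel L (cubic d (evenPeriod t)) (V₂ t) k')ᴴ + Matrix.diagonal (W t k')))⁻¹) k)⁻¹) 0)
        ((unitIdx L (cubic d (evenPeriod t))).symm (x, μ')) ((unitIdx L (cubic d (evenPeriod t))).symm (0, ν'))).re)
      = fun t μ' ν' (x : Site d (evenPeriod t)) =>
      (((∑ i ∈ Finset.univ, (fun i => (z i : ℂ)) i • ((((ℓ i).map (Option.map fun j => List.replicate j ())).map fun o => o.elim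
          (fun t k => (unitCovB L (cubic d (evenPeriod t)) a ha k)⁻¹)
          (fun w t k => avgTow (QBlev L (cubic d (evenPeriod t))) ((L : ℝ) ^ d)
            (fun k' => List.foldr (fun i N => calGlev L (cubic d (evenPeriod t)) a ha k' * (Pmodel L (cubic d (evenPeriod t)) ((fun _ : Unit => V₁) i t) k' + (Pmodel L (cubic d (evenPeriod t)) ((fun _ : Unit => V₂) i t) k')ᴴ + Matrix.diagonal ((fun _ : Unit => W) i t k')) * N)
              (calGlev L (cubic d (evenPeriod t)) a ha k') w) k)).prod)) t k)
        ((unitIdx L (cubic d (evenPeriod t))).symm (x, μ')) ((unitIdx L (cubic d (evenPeriod t))).symm (0, ν'))).re := by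
    funext t μ' ν' x
    rw [key t]
  rw [e]
  exact hIVL k

/-- **`conv_iteratedDeriv_effFormPert_coupling_of_tendsto_background` — EVERY u-DERIVATIVE OF THE EFFECTIVE FORM WITH BACKGROUND `Σ_k(u) = c_k(u)⁻¹ − a″1` AT `u = 0`, ORDER `N ≥ 1`, ON `ℤ^d`**
[our proof]: `∂^N_uΣ_k(u)|₀ = ∂^N_u(c_k(u)⁻¹)|₀` (`iteratedDeriv_const_add`), then `conv_iteratedDeriv_invPertCov_coupling_of_tendsto_background`.  PART 147 is `N = 1`, PART 157 is `N = 2`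
(up to the identification of the diagrams, PART 121); `N = 0` is PART 152 at `u = 0` ∕ PART 139. [cite: Balaban1987RG1, (1.21)–(1.22) p.264 (shapes)] -/
theorem conv_iteratedDeriv_effFormPert_coupling_of_tendsto_background (hL : 2 ≤ L) (hd : 3 ≤ d) {μ ν : Fin d} (hne : μ ≠ ν) {α β α' β' : ℝ}
    {V₁ V₂ : (t : ℕ) → (k : ℕ) → Fin d → (idx L (cubic d (evenPeriod t)) k → ℂ)} {W : (t : ℕ) → (k : ℕ) → (idx L (cubic d (evenPeriod t)) k → ℂ)}
    (hV₁ : ∀ t, LipschitzBackground L (cubic d (evenPeriod t)) (V₁ t) α β) (hV₂ : ∀ t, LipschitzBackground L (cubic d (evenPeriod t)) (V₂ t) α β)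
    (hW : ∀ t, BoundedBackground L (cubic d (evenPeriod t)) (W t) α' β')
    (hV₁1 : ∀ k (μ f : Fin d) (z : Fin d → ℤ), ∃ s : ℂ, Tendsto (fun t => V₁ t k μ (castT (cubic d (lev L k * evenPeriod t)) z, f)) atTop (𝓝 s))
    (hV₂1 : ∀ k (μ f : Fin d) (z : Fin d → ℤ), ∃ s : ℂ, Tendsto (fun t => V₂ t k μ (castT (cubic d (lev L k * evenPeriod t)) z, f)) atTop (𝓝 s))
    (hW1 : ∀ k (f : Fin d) (z : Fin d → ℤ), ∃ s : ℂ, Tendsto (fun t => W t k (castT (cubic d (lev L k * evenPeriod t)) z, f)) atTop (𝓝 s)) {N : ℕ} (hN : 0 < N)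
    (a'' : ℂ) :
    ∃ κ B B' : ℝ, 0 < κ ∧ 0 ≤ B ∧ 0 ≤ B' ∧ ∃ Pinf : ℕ → B12Beta.Kernel d,
      (∀ k, IsInfiniteVolumeLimit evenPeriod
        (fun t μ' ν' (z : Site d (evenPeriod t)) =>
          ((iteratedDeriv N (fun u : ℂ => (avgTow (QBlev L (cubic d (evenPeriod t))) ((L : ℝ) ^ d)
              (fun k' => (calDalev L (cubic d (evenPeriod t)) a ha k' + u • (Pmodel L (cubic d (evenPeriod t)) (V₁ t) k' + (Pmodel L (cubic d (evenPeriod t)) (V₂ t) k')ᴴ + Matrix.diagonal (W t k')))⁻¹) k)⁻¹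
              - a'' • (1 : Matrix (idx L (cubic d (evenPeriod t)) 0) (idx L (cubic d (evenPeriod t)) 0) ℂ)) 0)
            ((unitIdx L (cubic d (evenPeriod t))).symm (z, μ')) ((unitIdx L (cubic d (evenPeriod t))).symm (0, ν'))).re) (Pinf k)) ∧
      Beta.LimitRate.UniformDecay Pinf μ ν B (κ / d) ∧ StepRate Pinf μ ν B' (κ / d) (Real.sqrt ((L : ℝ)⁻¹)) ∧
      (∃ K : KernelInputs d Pinf, K.θ = Real.sqrt ((L : ℝ)⁻¹) ∧ K.c₀ = betaPrime510 d (B' / (1 - Real.sqrt ((L : ℝ)⁻¹))) (κ / d) ∧ K.Pinf = limKernelOf Pinf ∧ K.μ = μ ∧ K.ν = ν) ∧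
      (∀ k, |B12Beta.secondMoment (Pinf k) μ ν - B12Beta.secondMoment (limKernelOf Pinf) μ ν|
          ≤ betaPrime510 d (B' / (1 - Real.sqrt ((L : ℝ)⁻¹))) (κ / d) * Real.sqrt ((L : ℝ)⁻¹) ^ k) := by
  have e : ∀ t k, iteratedDeriv N (fun u : ℂ => (avgTow (QBlev L (cubic d (evenPeriod t))) ((L : ℝ) ^ d)
        (fun k' => (calDalev L (cubic d (evenPeriod t)) a ha k' + u • (Pmodel L (cubic d (evenPeriod t)) (V₁ t) k' + (Pmodel L (cubic d (evenPeriod t)) (V₂ t) k')ᴴ + Matrix.diagonal (W t k')))⁻¹) k)⁻¹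
        - a'' • (1 : Matrix (idx L (cubic d (evenPeriod t)) 0) (idx L (cubic d (evenPeriod t)) 0) ℂ)) 0
      = iteratedDeriv N (fun u : ℂ => (avgTow (QBlev L (cubic d (evenPeriod t))) ((L : ℝ) ^ d)
        (fun k' => (calDalev L (cubic d (evenPeriod t)) a ha k' + u • (Pmodel L (cubic d (evenPeriod t)) (V₁ t) k' + (Pmodel L (cubic d (evenPeriod t)) (V₂ t) k')ᴴ + Matrix.diagonal (W t k')))⁻¹) k)⁻¹) 0 := by
    intro t k
    have h := iteratedDeriv_const_add (𝕜 := ℂ) (x := (0 : ℂ)) hN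
      (-(a'' • (1 : Matrix (idx L (cubic d (evenPeriod t)) 0) (idx L (cubic d (evenPeriod t)) 0) ℂ)))
      (f := fun u : ℂ => (avgTow (QBlev L (cubic d (evenPeriod t))) ((L : ℝ) ^ d)
        (fun k' => (calDalev L (cubic d (evenPeriod t)) a ha k' + u • (Pmodel L (cubic d (evenPeriod t)) (V₁ t) k' + (Pmodel L (cubic d (evenPeriod t)) (V₂ t) k')ᴴ + Matrix.diagonal (W t k')))⁻¹) k)⁻¹)
    simp only [neg_add_eq_sub] at h
    exact h
  simp only [e]
  exact conv_iteratedDeriv_invPertCov_coupling_of_tendsto_background L a ha hL hd hne hV₁ hV₂ hW hV₁1 hV₂1 hW1 N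

end Line

/-! ## §2 THE INSTANCE: the exact abelian covariant Laplacian `Δ^{U} − Δ^{1}` along a volume-indexed family of transporters -/

section Covariant

variable {α β α' β' : ℝ} {u : (t : ℕ) → (k : ℕ) → Fin d → (idx L (cubic d (evenPeriod t)) k → ℂ)}

omit [NeZero L] in
/-- EL₁ of the connections `−w_t^{(k)} = −n_k(U_t^{(k)} − 1)` from EL₁ of the transporters (level by level, `n_k` is volume-free). [folklore] -/
theorem tendsto_connV_of_tendsto
    (hu1 : ∀ k (μ f : Fin d) (z : Fin d → ℤ), ∃ s : ℂ, Tendsto (fun t => u t k μ (castT (cubic d (lev L k * evenPeriod t)) z, f)) atTop (𝓝 s))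
    (k : ℕ) (μ f : Fin d) (z : Fin d → ℤ) :
    ∃ s : ℂ, Tendsto (fun t => connV L (cubic d (evenPeriod t)) (u t) k μ (castT (cubic d (lev L k * evenPeriod t)) z, f)) atTop (𝓝 s) := by
  obtain ⟨s, hs⟩ := hu1 k μ f z
  refine ⟨-(((lev L k : ℕ) : ℂ) * (s - 1)), ?_⟩
  simp only [connV, negConn, conn]
  exact ((hs.sub_const 1).const_mul _).neg

omit [NeZero L] in
/-- EL₁ of the zeroth-order fields `z_t^{(k)}` from EL₁ of the transporters: `z` is a finite stencil of `w` on `{x, x − e_ν}` (the reading of `z − e_ν` is `ẑ_t − e_ν`). [folklore] -/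
theorem tendsto_zT_of_tendsto
    (hu1 : ∀ k (μ f : Fin d) (z : Fin d → ℤ), ∃ s : ℂ, Tendsto (fun t => u t k μ (castT (cubic d (lev L k * evenPeriod t)) z, f)) atTop (𝓝 s))
    (k : ℕ) (f : Fin d) (z : Fin d → ℤ) :
    ∃ s : ℂ, Tendsto (fun t => zT L (cubic d (evenPeriod t)) (u t) k (castT (cubic d (lev L k * evenPeriod t)) z, f)) atTop (𝓝 s) := by
  -- EL₁ of the connection at `z` and at `z − e_ν`
  have hw : ∀ (ν : Fin d) (y : Fin d → ℤ), ∃ s : ℂ, Tendsto (fun t => conn (fine (lev L k) (cubic d (evenPeriod t))) ((lev L k : ℕ) : ℂ) (u t k) ν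
      (castT (cubic d (lev L k * evenPeriod t)) y, f)) atTop (𝓝 s) := by
    intro ν y
    obtain ⟨s, hs⟩ := hu1 k ν f y
    exact ⟨((lev L k : ℕ) : ℂ) * (s - 1), by simp only [conn]; exact (hs.sub_const 1).const_mul _⟩
  have e : ∀ t (ν : Fin d), tauInv (fine (lev L k) (cubic d (evenPeriod t))) ν (castT (cubic d (lev L k * evenPeriod t)) z, f)
      = (castT (cubic d (lev L k * evenPeriod t)) (z - Pi.single ν 1), f) := by
    intro t ν
    simp only [tauInv]
    rw [sub_eq_add_neg z, castT_add, castT_neg, castT_single, ← sub_eq_add_neg]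
    rfl
  choose sw hsw using hw
  refine ⟨∑ ν, (star (sw ν (z - Pi.single ν 1)) * sw ν (z - Pi.single ν 1) - ((lev L k : ℕ) : ℂ) * (sw ν z - sw ν (z - Pi.single ν 1))
      - ((lev L k : ℕ) : ℂ) * (star (sw ν z) - star (sw ν (z - Pi.single ν 1)))), ?_⟩
  simp only [zT, zfield, e]
  exact tendsto_finsetSum _ fun ν _ =>
    ((((hsw ν (z - Pi.single ν 1)).star).mul (hsw ν (z - Pi.single ν 1))).sub (((hsw ν z).sub (hsw ν (z - Pi.single ν 1))).const_mul _)).sub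
      ((((hsw ν z).star).sub ((hsw ν (z - Pi.single ν 1)).star)).const_mul _)

/-- **`conv_iteratedDeriv_invCov_covariantLaplacian_of_tendsto` — EVERY u-DERIVATIVE AT `u = 0` OF `(c_k(u))⁻¹` ALONG THE EXACT ABELIAN COVARIANT LAPLACIAN LINE
`u ↦ Δ_a^{(k)} + u·(Δ^{U_{t,k}} − Δ^{1,(k)})`, ON `ℤ^d`, MODULO ONLY EL₁ OF THE TRANSPORTERS** [our proof] (`d ≥ 3`, `L ≥ 2`, `a > 0`, `μ ≠ ν`, even cubic volumes `2(t+1)`, every order `N`;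
a volume-indexed family of abelian transporters `U_t` — `u t k ν x = U_t(x, x + η_ke_ν)` — whose connections `−w_t = connV (u t)` are Lipschitz `(α, β)` and zeroth-order fields
`z_t = zT (u t)` bounded `(α′, β′)` uniformly in `t`, DISPLAYING ONLY EL₁ of `u_t`): `Δ^{U} − Δ^{1} = covPert u = P(−w) + P(−w)ᴴ + diag z` (NE2's `covPert_eq`, EXACT), so §2 applies with
`V₁ = V₂ = −w_t`, `W = z_t` (EL₁ by `tendsto_connV_of_tendsto` ∕ `tendsto_zT_of_tendsto`).  `N = 0` is the free effective form (PART 139); the `N`-th term is the `N`-th Neumann coefficient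
of the effective form of `Δ_a + (Δ^U − Δ^1)`. [cite: Balaban1985BackgroundPropagators, (3.3) p.390 (covariant derivative, shape); Balaban1987RG1, (1.21)–(1.22) p.264 (shapes)] -/
theorem conv_iteratedDeriv_invCov_covariantLaplacian_of_tendsto (hL : 2 ≤ L) (hd : 3 ≤ d) {μ ν : Fin d} (hne : μ ≠ ν)
    (hV : ∀ t, LipschitzBackground L (cubic d (evenPeriod t)) (connV L (cubic d (evenPeriod t)) (u t)) α β)
    (hz : ∀ t, BoundedBackground L (cubic d (evenPeriod t)) (zT L (cubic d (evenPeriod t)) (u t)) α' β')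
    (hu1 : ∀ k (μ f : Fin d) (z : Fin d → ℤ), ∃ s : ℂ, Tendsto (fun t => u t k μ (castT (cubic d (lev L k * evenPeriod t)) z, f)) atTop (𝓝 s)) (N : ℕ) :
    ∃ κ B B' : ℝ, 0 < κ ∧ 0 ≤ B ∧ 0 ≤ B' ∧ ∃ Pinf : ℕ → B12Beta.Kernel d,
      (∀ k, IsInfiniteVolumeLimit evenPeriod
        (fun t μ' ν' (z : Site d (evenPeriod t)) =>
          ((iteratedDeriv N (fun s : ℂ => (avgTow (QBlev L (cubic d (evenPeriod t))) ((L : ℝ) ^ d)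
              (fun k' => (calDalev L (cubic d (evenPeriod t)) a ha k' + s • covPert L (cubic d (evenPeriod t)) (u t) k')⁻¹) k)⁻¹) 0)
            ((unitIdx L (cubic d (evenPeriod t))).symm (z, μ')) ((unitIdx L (cubic d (evenPeriod t))).symm (0, ν'))).re) (Pinf k)) ∧
      Beta.LimitRate.UniformDecay Pinf μ ν B (κ / d) ∧ StepRate Pinf μ ν B' (κ / d) (Real.sqrt ((L : ℝ)⁻¹)) ∧
      (∃ K : KernelInputs d Pinf, K.θ = Real.sqrt ((L : ℝ)⁻¹) ∧ K.c₀ = betaPrime510 d (B' / (1 - Real.sqrt ((L : ℝ)⁻¹))) (κ / d) ∧ K.Pinf = limKernelOf Pinf ∧ K.μ = μ ∧ K.ν = ν) ∧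
      (∀ k, |B12Beta.secondMoment (Pinf k) μ ν - B12Beta.secondMoment (limKernelOf Pinf) μ ν|
          ≤ betaPrime510 d (B' / (1 - Real.sqrt ((L : ℝ)⁻¹))) (κ / d) * Real.sqrt ((L : ℝ)⁻¹) ^ k) := by
  have e : ∀ t k', covPert L (cubic d (evenPeriod t)) (u t) k'
      = Pmodel L (cubic d (evenPeriod t)) (connV L (cubic d (evenPeriod t)) (u t)) k' + (Pmodel L (cubic d (evenPeriod t)) (connV L (cubic d (evenPeriod t)) (u t)) k')ᴴ
        + Matrix.diagonal (zT L (cubic d (evenPeriod t)) (u t) k') := fun t k' => covPert_eq L (cubic d (evenPeriod t)) (u t) k'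
  simp only [e]
  exact conv_iteratedDeriv_invPertCov_coupling_of_tendsto_background L a ha hL hd hne hV hV hz (tendsto_connV_of_tendsto L hu1) (tendsto_connV_of_tendsto L hu1)
    (tendsto_zT_of_tendsto L hu1) N

/-- **`conv_iteratedDeriv_effForm_covariantLaplacian_of_tendsto` — THE SAME FOR THE EFFECTIVE FORM `Σ_k(u) = c_k(u)⁻¹ − a″1`, ORDER `N ≥ 1`**, along the exact abelian covariant
Laplacian line. [cite: Balaban1985BackgroundPropagators, (3.3) p.390 (shape); Balaban1987RG1, (1.21)–(1.22) p.264 (shapes)] -/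
theorem conv_iteratedDeriv_effForm_covariantLaplacian_of_tendsto (hL : 2 ≤ L) (hd : 3 ≤ d) {μ ν : Fin d} (hne : μ ≠ ν)
    (hV : ∀ t, LipschitzBackground L (cubic d (evenPeriod t)) (connV L (cubic d (evenPeriod t)) (u t)) α β)
    (hz : ∀ t, BoundedBackground L (cubic d (evenPeriod t)) (zT L (cubic d (evenPeriod t)) (u t)) α' β')
    (hu1 : ∀ k (μ f : Fin d) (z : Fin d → ℤ), ∃ s : ℂ, Tendsto (fun t => u t k μ (castT (cubic d (lev L k * evenPeriod t)) z, f)) atTop (𝓝 s)) {N : ℕ} (hN : 0 < N)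
    (a'' : ℂ) :
    ∃ κ B B' : ℝ, 0 < κ ∧ 0 ≤ B ∧ 0 ≤ B' ∧ ∃ Pinf : ℕ → B12Beta.Kernel d,
      (∀ k, IsInfiniteVolumeLimit evenPeriod
        (fun t μ' ν' (z : Site d (evenPeriod t)) =>
          ((iteratedDeriv N (fun s : ℂ => (avgTow (QBlev L (cubic d (evenPeriod t))) ((L : ℝ) ^ d)
              (fun k' => (calDalev L (cubic d (evenPeriod t)) a ha k' + s • covPert L (cubic d (evenPeriod t)) (u t) k')⁻¹) k)⁻¹
              - a'' • (1 : Matrix (idx L (cubic d (evenPeriod t)) 0) (idx L (cubic d (evenPeriod t)) 0) ℂ)) 0)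
            ((unitIdx L (cubic d (evenPeriod t))).symm (z, μ')) ((unitIdx L (cubic d (evenPeriod t))).symm (0, ν'))).re) (Pinf k)) ∧
      Beta.LimitRate.UniformDecay Pinf μ ν B (κ / d) ∧ StepRate Pinf μ ν B' (κ / d) (Real.sqrt ((L : ℝ)⁻¹)) ∧
      (∃ K : KernelInputs d Pinf, K.θ = Real.sqrt ((L : ℝ)⁻¹) ∧ K.c₀ = betaPrime510 d (B' / (1 - Real.sqrt ((L : ℝ)⁻¹))) (κ / d) ∧ K.Pinf = limKernelOf Pinf ∧ K.μ = μ ∧ K.ν = ν) ∧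
      (∀ k, |B12Beta.secondMoment (Pinf k) μ ν - B12Beta.secondMoment (limKernelOf Pinf) μ ν|
          ≤ betaPrime510 d (B' / (1 - Real.sqrt ((L : ℝ)⁻¹))) (κ / d) * Real.sqrt ((L : ℝ)⁻¹) ^ k) := by
  have e : ∀ t k', covPert L (cubic d (evenPeriod t)) (u t) k'
      = Pmodel L (cubic d (evenPeriod t)) (connV L (cubic d (evenPeriod t)) (u t)) k' + (Pmodel L (cubic d (evenPeriod t)) (connV L (cubic d (evenPeriod t)) (u t)) k')ᴴ
        + Matrix.diagonal (zT L (cubic d (evenPeriod t)) (u t) k') := fun t k' => covPert_eq L (cubic d (evenPeriod t)) (u t) k'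
  simp only [e]
  exact conv_iteratedDeriv_effFormPert_coupling_of_tendsto_background L a ha hL hd hne hV hV hz (tendsto_connV_of_tendsto L hu1) (tendsto_connV_of_tendsto L hu1)
    (tendsto_zT_of_tendsto L hu1) hN a''

end Covariant

end Summit.QuantumFields.BalabanUV.Beta.GAN24.CovariantLaplacianTaylorLine

end
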